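import Summits.QuantumAdvantage.AdviceFreeQNC0.ProductGameSmallBlocks
import Summits.QuantumAdvantage.AdviceFreeQNC0.PLDAMSAllDensities
import Summits.QuantumAdvantage.AdviceFreeQNC0.EliminationHardness
import HarnessLib

/-!
# Cell qa-qnc0 — the product, cross-team, walk and RING games are hard up to degree `c·√(log n)`

UNCONDITIONAL rung on crux α (`RingToElim` ⟺ `RingHard 2`, stmt-QuantumAdvantage-19119) of the
route `RingFrame`: planner qa-qnc0-p1's conditional "Theorem U" (TARGET §17.3: PLDAMS + ElimSqrt
⇒ a `D`-uniform product constant for `D ≤ c'√(log ℓ)`) made unconditional by the tree theorems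
`pldams_allDensities` (PLDAMS at every density, `d ≤ c√n`) and `elimSqrtDec_of_lowDegAvoidMod3Sparse
lowDegAvoidMod3Sparse` (two-bit elimination fails on `η₀·2ⁿ` inputs at degree `≤ c₀√n`), and
threaded through the degree-EXACT outer stubs of both registered lines
(`crossTeamHard_of_productHard`, `ringHardU_of_crossTeamHard`, `ringHard_two_of_walkHard` —
re-run here at degree `c√log` instead of polylog):

* `productHard_sqrtLog` — `∃ μ>0, c>0, L₀: ∀ L, L' ≥ L₀, ∀ D ≤ c·√(log₂ min(L,L'))`, every pair
  (columns of `X` / rows of `Y` = win patterns of degree-`≤ D` stakes-eliminators) agrees on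
  `≥ μ·2^{L+L'}` cells. PROOF: restrict the rows to their first `L'' = ⌊log₂ L⌋/4` bits
  (`productHard_mono_right`); at row length `L''` the potential costs are constant on the ATOMS of
  Alice's column map, whose indicators have degree `≤ 2^{L''}·D ≤ c_P√L`, so PLDAMS gives the
  weighted residue non-avoidance `LDMA` (`ldma_of_pldams_atoms`), and the minimum fail weight at
  length `L''` is `≥ η₀ 2^{L''}` because `D ≤ c₀√L''` (`le_distFail_zero_of`); `μ = κη₀`.
* `crossTeamHard_sqrtLog` (XOR law), `walkHard_sqrtLog` (block embedding, `n = L + L'`),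
* `ringHard_sqrtLogDeg` — **every `𝔽₂`-polynomial strategy of degree `≤ c·√(log₂ n)` solves the
  ring relation `RingHLF.Rel` on at most `θ·2ⁿ` inputs, `θ < 1` absolute, all large `n`.**

WHAT THIS IS NOT: not `RingHard 2` (degree `(log₂ n)^C` for every `C`), not the banked aside
`RingHardLogDeg` (degree `log₄ n − log₄(log₂ n + 1) − 3`, stmt-QuantumAdvantage-19453): the atom
argument caps the row length at `L'' ≍ log L` and elimination hardness at length `L''` caps the
degree at `√L'' ≍ √(log L)`. The constants `μ, c, 1 − θ` are absolute but astronomically small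
(inherited from `pldams_allDensities`). No separation is claimed.
-/

namespace Summit.QuantumAdvantage.AdviceFreeQNC0

open Finset Literature.Computability.QuantumComplexity Literature.Computability.QuantumComplexity.RingHLF
open Literature.Computability.MetaComplexity Literature.Computability.MetaComplexity.Smolensky

/-! ### Growth bookkeeping -/

/-- `ℓ · 4^{⌊ℓ/4⌋} ≤ 2 · 2^ℓ`. -/
private theorem mul_four_pow_div_le (ℓ : ℕ) : ℓ * 4 ^ (ℓ / 4) ≤ 2 * 2 ^ ℓ := by
  have h1 : ℓ / 2 < 2 ^ (ℓ / 2) := Nat.lt_two_pow_self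
  have h2 : ℓ ≤ 2 * 2 ^ (ℓ / 2) := by omega
  have h3 : 4 ^ (ℓ / 4) ≤ 2 ^ (ℓ / 2) := by
    rw [show (4 : ℕ) = 2 ^ 2 by norm_num, ← pow_mul]
    exact Nat.pow_le_pow_right (by norm_num) (by omega)
  calc ℓ * 4 ^ (ℓ / 4) ≤ (2 * 2 ^ (ℓ / 2)) * 2 ^ (ℓ / 2) := Nat.mul_le_mul h2 h3
    _ = 2 * 2 ^ (ℓ / 2 + ℓ / 2) := by rw [pow_add]; ring
    _ ≤ 2 * 2 ^ ℓ := Nat.mul_le_mul_left 2 (Nat.pow_le_pow_right (by norm_num) (by omega))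

/-- The atom degree is in PLDAMS range: `2^{⌊ℓ/4⌋}·(c√ℓ) ≤ (2c)·√L` for `ℓ = ⌊log₂ L⌋`. -/
private theorem two_pow_mul_sqrt_log_le {c : ℝ} (hc : 0 ≤ c) {L : ℕ} (hL : L ≠ 0) :
    (2 : ℝ) ^ (Nat.log 2 L / 4) * (c * Real.sqrt (Nat.log 2 L)) ≤ (2 * c) * Real.sqrt L := by
  set ℓ := Nat.log 2 L with hℓ
  have hpow : 2 ^ ℓ ≤ L := Nat.pow_log_le_self 2 hL
  have hnat : ℓ * 4 ^ (ℓ / 4) ≤ 2 * L := le_trans (mul_four_pow_div_le ℓ) (by omega)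
  have hreal : (ℓ : ℝ) * (4 : ℝ) ^ (ℓ / 4) ≤ 2 * (L : ℝ) := by exact_mod_cast hnat
  -- square both sides
  have hsq : ((2 : ℝ) ^ (ℓ / 4) * Real.sqrt ℓ) ^ 2 ≤ (Real.sqrt 2 * Real.sqrt L) ^ 2 := by
    rw [mul_pow, mul_pow, Real.sq_sqrt (Nat.cast_nonneg _), Real.sq_sqrt (by norm_num),
      Real.sq_sqrt (Nat.cast_nonneg _), ← pow_mul, show (2 : ℝ) ^ (ℓ / 4 * 2) = 4 ^ (ℓ / 4) by
        rw [mul_comm, pow_mul]; norm_num]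
    linarith
  have hle : (2 : ℝ) ^ (ℓ / 4) * Real.sqrt ℓ ≤ Real.sqrt 2 * Real.sqrt L := by
    have h := Real.sqrt_le_sqrt hsq
    rwa [Real.sqrt_sq (by positivity), Real.sqrt_sq (by positivity)] at h
  have h2 : Real.sqrt 2 ≤ 2 := by
    rw [show (2 : ℝ) = Real.sqrt 4 by rw [show (4 : ℝ) = 2 ^ 2 by norm_num, Real.sqrt_sq (by norm_num)]]
    exact Real.sqrt_le_sqrt (by norm_num)
  calc (2 : ℝ) ^ (ℓ / 4) * (c * Real.sqrt ℓ) = c * ((2 : ℝ) ^ (ℓ / 4) * Real.sqrt ℓ) := by ring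
    _ ≤ c * (Real.sqrt 2 * Real.sqrt L) := mul_le_mul_of_nonneg_left hle hc
    _ ≤ c * (2 * Real.sqrt L) := by
        refine mul_le_mul_of_nonneg_left ?_ hc
        exact mul_le_mul_of_nonneg_right h2 (Real.sqrt_nonneg _)
    _ = (2 * c) * Real.sqrt L := by ring

/-- `√ℓ ≤ 3·√⌊ℓ/4⌋` for `ℓ ≥ 6`. -/
private theorem sqrt_le_three_sqrt_div (ℓ : ℕ) (hℓ : 6 ≤ ℓ) :
    Real.sqrt ℓ ≤ 3 * Real.sqrt ((ℓ / 4 : ℕ) : ℝ) := by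
  have hnat : ℓ ≤ 9 * (ℓ / 4) := by omega
  have hreal : (ℓ : ℝ) ≤ 9 * ((ℓ / 4 : ℕ) : ℝ) := by exact_mod_cast hnat
  calc Real.sqrt ℓ ≤ Real.sqrt (9 * ((ℓ / 4 : ℕ) : ℝ)) := Real.sqrt_le_sqrt hreal
    _ = 3 * Real.sqrt ((ℓ / 4 : ℕ) : ℝ) := by
        rw [Real.sqrt_mul (by norm_num), show (9 : ℝ) = 3 ^ 2 by norm_num,
          Real.sqrt_sq (by norm_num)]

/-- Monotonicity of the degree budget: `√(log₂ m) ≤ √(log₂ n)` for `m ≤ n`. -/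
private theorem sqrt_log_mono {m n : ℕ} (h : m ≤ n) :
    Real.sqrt (Nat.log 2 m) ≤ Real.sqrt (Nat.log 2 n) :=
  Real.sqrt_le_sqrt (by exact_mod_cast Nat.log_mono_right h)

/-- `√(log₂ n) ≤ √n`. -/
private theorem sqrt_log_le_sqrt (n : ℕ) : Real.sqrt (Nat.log 2 n) ≤ Real.sqrt n :=
  Real.sqrt_le_sqrt (by exact_mod_cast Nat.log_le_self 2 n)

/-! ### The product game up to degree `c·√(log₂ min(L, L'))` -/

/-- **The product game is hard up to degree `c·√(log₂ min(L,L'))`** ("Theorem U" of TARGET §17.3,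
unconditional): there are absolute `μ, c > 0` such that for all large `L, L'` and every
`D ≤ c·√(log₂ min(L,L'))`, if every column of `X` and every row of `Y` is the win pattern of a
stakes-eliminator of degree `≤ D`, then `X` and `Y` agree on at least `μ·2^{L+L'}` cells. -/
theorem productHard_sqrtLog :
    ∃ μ : ℝ, 0 < μ ∧ ∃ c : ℝ, 0 < c ∧ ∃ L₀ : ℕ, ∀ L L' : ℕ, L₀ ≤ L → L₀ ≤ L' → ∀ D : ℕ,
      (D : ℝ) ≤ c * Real.sqrt (Nat.log 2 (min L L')) →
      ∀ X Y : (Fin L → Bool) → (Fin L' → Bool) → Bool,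
        (∀ v, IsElimWin D (fun u => X u v)) → (∀ u, IsElimWin D (fun v => Y u v)) →
          μ * (2 : ℝ) ^ (L + L') ≤ (agreeCountR X Y : ℝ) := by
  classical
  obtain ⟨κ, hκ, cP, hcP, nP, hP⟩ := pldams_allDensities
  obtain ⟨η₀, hη₀, c₀, hc₀, nE, hE⟩ := elimSqrtDec_of_lowDegAvoidMod3Sparse lowDegAvoidMod3Sparse
  refine ⟨κ * η₀, mul_pos hκ hη₀, min (cP / 2) (c₀ / 3), lt_min (by positivity) (by positivity),
    max (max nP nE) (2 ^ (4 * nE + 24)), fun L L' hL hL' D hD X Y hX hY => ?_⟩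
  set c := min (cP / 2) (c₀ / 3) with hc
  have hc_pos : 0 < c := lt_min (by positivity) (by positivity)
  have hcP' : c ≤ cP / 2 := min_le_left _ _
  have hc₀' : c ≤ c₀ / 3 := min_le_right _ _
  have hLnP : nP ≤ L := le_trans (le_trans (le_max_left _ _) (le_max_left _ _)) hL
  have hL'nE : nE ≤ L' := le_trans (le_trans (le_max_right _ _) (le_max_left _ _)) hL'
  have hLpow : 2 ^ (4 * nE + 24) ≤ L := le_trans (le_max_right _ _) hL
  have hL0 : L ≠ 0 := by have := Nat.one_le_two_pow (n := 4 * nE + 24); omega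
  -- the small row length `L'' = ⌊log₂ L⌋ / 4`
  set ℓ := Nat.log 2 L with hℓ
  have hℓge : 4 * nE + 24 ≤ ℓ := Nat.le_log_of_pow_le (by norm_num) hLpow
  set L'' := ℓ / 4 with hL''
  have hL''nE : nE ≤ L'' := by omega
  have hℓ6 : 6 ≤ ℓ := by omega
  -- the degree budget in terms of `ℓ`
  have hDℓ : (D : ℝ) ≤ c * Real.sqrt ℓ :=
    le_trans hD (mul_le_mul_of_nonneg_left (sqrt_log_mono (min_le_left L L')) hc_pos.le)
  -- the base step at any row length `Ls ≤ L''` that is `≥ nE` and carries the degree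
  have base : ∀ Ls : ℕ, nE ≤ Ls → Ls ≤ L'' → (D : ℝ) ≤ c₀ * Real.sqrt Ls →
      ∀ X' Y' : (Fin L → Bool) → (Fin Ls → Bool) → Bool,
        (∀ v, IsElimWin D (fun u => X' u v)) → (∀ u, IsElimWin D (fun v => Y' u v)) →
          κ * η₀ * (2 : ℝ) ^ (L + Ls) ≤ (agreeCountR X' Y' : ℝ) := by
    intro Ls hLs₁ hLs₂ hDLs X' Y' hX' hY'
    -- atom degree `2^{Ls}·D ≤ cP·√L`
    have hdeg : ((2 ^ Ls * D : ℕ) : ℝ) ≤ cP * Real.sqrt L := by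
      push_cast
      calc (2 : ℝ) ^ Ls * (D : ℝ) ≤ (2 : ℝ) ^ L'' * (c * Real.sqrt ℓ) := by
            refine mul_le_mul (pow_le_pow_right₀ (by norm_num) hLs₂) hDℓ (Nat.cast_nonneg _)
              (by positivity)
        _ ≤ (2 * c) * Real.sqrt L := two_pow_mul_sqrt_log_le hc_pos.le hL0
        _ ≤ cP * Real.sqrt L := by
            refine mul_le_mul_of_nonneg_right ?_ (Real.sqrt_nonneg _)
            linarith
    refine agree_ge_of_ldma hκ.le (fun Γ hΓ r => ?_) ?_ X' Y' hX' hY'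
    · refine ldma_of_pldams_atoms (fun g hg r' => ?_) Γ hΓ (distFail D) r
      exact hP L hLnP r' (2 ^ Ls * D) hdeg g hg
    · exact le_distFail_zero_of fun a b ha hb dec => hE Ls hLs₁ D hDLs a b ha hb dec
  by_cases hcase : L'' ≤ L'
  · -- restrict the rows to their first `L''` bits
    obtain ⟨M, hM⟩ := Nat.exists_eq_add_of_le hcase
    subst hM
    have hDL'' : (D : ℝ) ≤ c₀ * Real.sqrt L'' := by
      calc (D : ℝ) ≤ c * Real.sqrt ℓ := hDℓ
        _ ≤ (c₀ / 3) * (3 * Real.sqrt ((ℓ / 4 : ℕ) : ℝ)) :=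
            mul_le_mul hc₀' (sqrt_le_three_sqrt_div ℓ hℓ6) (Real.sqrt_nonneg _) (by positivity)
        _ = c₀ * Real.sqrt L'' := by rw [hL'']; ring
    exact productHard_mono_right (fun X' Y' hX' hY' => base L'' hL''nE le_rfl hDL'' X' Y' hX' hY')
      M X Y hX hY
  · -- the rows are already short
    have hL'le : L' ≤ L'' := by omega
    have hDL' : (D : ℝ) ≤ c₀ * Real.sqrt L' := by
      calc (D : ℝ) ≤ c * Real.sqrt (Nat.log 2 (min L L')) := hD
        _ ≤ c * Real.sqrt L' := by
            refine mul_le_mul_of_nonneg_left ?_ hc_pos.le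
            exact le_trans (sqrt_log_mono (min_le_right L L')) (sqrt_log_le_sqrt L')
        _ ≤ c₀ * Real.sqrt L' := by
            refine mul_le_mul_of_nonneg_right ?_ (Real.sqrt_nonneg _)
            linarith
    exact base L' hL'nE hL'le hDL' X Y hX hY

/-! ### The cross-team and walk games -/

/-- **The cross-team game is hard up to cross-degree `c·√(log₂ min(L,L'))`** (three-mode XOR law,
`θ = 1 − μ`). -/
theorem crossTeamHard_sqrtLog :
    ∃ θ : ℝ, θ < 1 ∧ ∃ c : ℝ, 0 < c ∧ ∃ L₀ : ℕ, ∀ L L' : ℕ, L₀ ≤ L → L₀ ≤ L' → ∀ D : ℕ,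
      (D : ℝ) ≤ c * Real.sqrt (Nat.log 2 (min L L')) →
      ∀ cc : ℕ, ∀ F₀ : (Fin L → Bool) → (Fin L' → Bool) → T4,
        ∀ F₁ : (Fin L' → Bool) → (Fin L → Bool) → T4, CrossDeg D F₀ → CrossDeg D F₁ →
          (crossWinCount cc F₀ F₁ : ℝ) ≤ θ * (2 : ℝ) ^ (L + L') := by
  obtain ⟨μ, hμ, c, hc, L₀, hP⟩ := productHard_sqrtLog
  refine ⟨1 - μ, by linarith, c, hc, L₀, fun L L' hL hL' D hD cc F₀ F₁ hF₀ hF₁ => ?_⟩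
  have hagree := hP L L' hL hL' D hD (win1 cc F₁) (win0 cc F₀) (isElimWin_win1 cc hF₁)
    (isElimWin_win0 cc hF₀)
  have htot : (crossWinCount cc F₀ F₁ : ℝ) + (agreeCountR (win1 cc F₁) (win0 cc F₀) : ℝ) =
      (2 : ℝ) ^ (L + L') := by
    exact_mod_cast crossWinCount_add_agree cc F₀ F₁
  linarith

/-- **The walk game at charge `n + 2` is hard up to degree `c·√(log₂ n)`**: split `n = L + L'`
with `L = ⌊n/2⌋`; the win set of a walk strategy is the cross-team win set of its block profiles
`F0 y`, `F1 y`, which have cross-degree equal to the strategy's degree. -/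
theorem walkHard_sqrtLog :
    ∃ θ : ℝ, θ < 1 ∧ ∃ c : ℝ, 0 < c ∧ ∃ n₀ : ℕ, ∀ n ≥ n₀, ∀ D : ℕ,
      (D : ℝ) ≤ c * Real.sqrt (Nat.log 2 n) →
      ∀ y : Fin (n + 1) → (Fin n → Bool) → Bool, (∀ g, HasDeg (y g) D) →
        ((univ.filter fun u : Fin n → Bool => ringWinU (n + 2) y u = true).card : ℝ) ≤
          θ * (2 : ℝ) ^ n := by
  obtain ⟨θ, hθ, c, hc, L₀, hCT⟩ := crossTeamHard_sqrtLog
  refine ⟨θ, hθ, c / 2, by positivity, 2 * L₀ + 4, fun n hn D hD y hy => ?_⟩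
  -- degree budget: `(c/2)·√(log₂ n) ≤ c·√(log₂ ⌊n/2⌋)`
  have hlog : Nat.log 2 n ≤ 4 * Nat.log 2 (n / 2) := by
    rw [Nat.log_div_base]
    have : 2 ≤ Nat.log 2 n := Nat.le_log_of_pow_le (by norm_num) (by omega)
    omega
  have hdeg : (D : ℝ) ≤ c * Real.sqrt (Nat.log 2 (min (n / 2) (n - n / 2))) := by
    rw [min_eq_left (by omega)]
    have hreal : (Nat.log 2 n : ℝ) ≤ 4 * (Nat.log 2 (n / 2) : ℝ) := by exact_mod_cast hlog
    calc (D : ℝ) ≤ c / 2 * Real.sqrt (Nat.log 2 n) := hD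
      _ ≤ c / 2 * Real.sqrt (4 * (Nat.log 2 (n / 2) : ℝ)) :=
          mul_le_mul_of_nonneg_left (Real.sqrt_le_sqrt hreal) (by positivity)
      _ = c * Real.sqrt (Nat.log 2 (n / 2)) := by
          rw [Real.sqrt_mul (by norm_num), show (4 : ℝ) = 2 ^ 2 by norm_num,
            Real.sqrt_sq (by norm_num)]
          ring
  obtain ⟨L, L', hL, hL', hdeg', rfl⟩ : ∃ L L' : ℕ, L₀ ≤ L ∧ L₀ ≤ L' ∧
      (D : ℝ) ≤ c * Real.sqrt (Nat.log 2 (min L L')) ∧ n = L + L' :=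
    ⟨n / 2, n - n / 2, by omega, by omega, hdeg, by omega⟩
  have hcount := hCT L L' hL hL' D hdeg' (L + L' + 2) (F0 y) (F1 y) (crossDeg_F0 y hy)
    (crossDeg_F1 y hy)
  rw [card_ringWinU_eq]
  exact hcount

/-! ### The ring game -/

/-- **Ring-game hardness up to degree `c·√(log₂ n)`** (unconditional rung on crux α = `RingHard 2`
of `Summits.QuantumAdvantage.QuantumAdvantage.Theses.RingFrame`): there are absolute `θ < 1`,
`c > 0` such that for all large `n`, every tuple `P` of `𝔽₂`-polynomials of degree
`≤ c·√(log₂ n)` satisfies the ring relation `RingHLF.Rel x (P x)` for at most `θ·2ⁿ` inputs `x`.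
(`RingHard 2` asks the same at degree `(log₂ n)^C` for every `C`; the banked aside
`RingHardLogDeg` at degree `≍ ½ log₂ n`.) -/
theorem ringHard_sqrtLogDeg :
    ∃ θ : ℝ, θ < 1 ∧ ∃ c : ℝ, 0 < c ∧ ∃ n₀ : ℕ, ∀ n ≥ n₀, ∀ d : ℕ,
      (d : ℝ) ≤ c * Real.sqrt (Nat.log 2 n) →
      ∀ P : Fin n → CubeFn (ZMod 2) n, (∀ i, P i ∈ lowDeg (ZMod 2) n d) →
        ((univ.filter fun x : Fin n → Bool => Rel x (fun i => decide (P i x = 1))).card : ℝ) ≤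
          θ * (2 : ℝ) ^ n := by
  classical
  obtain ⟨θ', hθ', c, hc, n₀, hW⟩ := walkHard_sqrtLog
  -- `n₁`: from here on the budget `c·√(log₂ n)` is at least `1` (room for degree-0 strategies)
  obtain ⟨n₁, hn₁⟩ : ∃ n₁ : ℕ, ∀ n ≥ n₁, (1 : ℝ) ≤ c * Real.sqrt (Nat.log 2 n) := by
    refine ⟨2 ^ Nat.ceil (1 / c ^ 2), fun n hn => ?_⟩
    have hlog : Nat.ceil (1 / c ^ 2) ≤ Nat.log 2 n := Nat.le_log_of_pow_le (by norm_num) hn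
    have h1 : 1 / c ^ 2 ≤ (Nat.log 2 n : ℝ) := le_trans (Nat.le_ceil _) (by exact_mod_cast hlog)
    have h2 : Real.sqrt (1 / c ^ 2) ≤ Real.sqrt (Nat.log 2 n) := Real.sqrt_le_sqrt h1
    rw [Real.sqrt_div' _ (sq_nonneg c), Real.sqrt_one, Real.sqrt_sq hc.le] at h2
    calc (1 : ℝ) = c * (1 / c) := by field_simp
      _ ≤ c * Real.sqrt (Nat.log 2 n) := mul_le_mul_of_nonneg_left h2 hc.le
  refine ⟨(1 + θ') / 2, by linarith, c / 2, by positivity, max (max (n₀ + 1) (n₁ + 1)) 5,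
    fun N hN d hd P hP => ?_⟩
  obtain ⟨n, rfl⟩ : ∃ n, N = n + 1 := ⟨N - 1, by omega⟩
  have hn₀n : n₀ ≤ n := by have := le_max_left (max (n₀ + 1) (n₁ + 1)) 5; omega
  have hn₁n : n₁ ≤ n := by have := le_max_left (max (n₀ + 1) (n₁ + 1)) 5; omega
  have hn4 : 4 ≤ n := by have := le_max_right (max (n₀ + 1) (n₁ + 1)) 5; omega
  -- the degree of the transported strategy: `D = max d 1 ≤ c·√(log₂ n)`
  set D := max d 1 with hDdef
  have hone : 1 ≤ D := le_max_right _ _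
  have hlog : Nat.log 2 (n + 1) ≤ 4 * Nat.log 2 n := by
    have h1 : Nat.log 2 (n + 1) ≤ Nat.log 2 n + 1 := by
      have h : n + 1 ≤ 2 ^ (Nat.log 2 n + 1) := Nat.lt_pow_succ_log_self (by norm_num) n
      calc Nat.log 2 (n + 1) ≤ Nat.log 2 (2 ^ (Nat.log 2 n + 1)) := Nat.log_mono_right h
        _ = Nat.log 2 n + 1 := Nat.log_pow (by norm_num) _
    have h2 : 2 ≤ Nat.log 2 n := Nat.le_log_of_pow_le (by norm_num) (by omega)
    omega
  have hD : (D : ℝ) ≤ c * Real.sqrt (Nat.log 2 n) := by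
    rcases le_total d 1 with h | h
    · rw [hDdef, max_eq_right h]
      push_cast
      exact hn₁ n hn₁n
    · rw [hDdef, max_eq_left h]
      have hreal : (Nat.log 2 (n + 1) : ℝ) ≤ 4 * (Nat.log 2 n : ℝ) := by exact_mod_cast hlog
      calc (d : ℝ) ≤ c / 2 * Real.sqrt (Nat.log 2 (n + 1)) := hd
        _ ≤ c / 2 * Real.sqrt (4 * (Nat.log 2 n : ℝ)) :=
            mul_le_mul_of_nonneg_left (Real.sqrt_le_sqrt hreal) (by positivity)
        _ = c * Real.sqrt (Nat.log 2 n) := by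
            rw [Real.sqrt_mul (by norm_num), show (4 : ℝ) = 2 ^ 2 by norm_num,
              Real.sqrt_sq (by norm_num)]
            ring
  -- the transported walk strategy and its degree
  set z : (Fin (n + 1) → Bool) → (Fin (n + 1) → Bool) := fun x i => decide (P i x = 1) with hz
  set y : Fin (n + 1) → (Fin n → Bool) → Bool :=
    fun g u => xor (z (xOfU u) g) (tGuess (xOfU u) g) with hy
  have hdeg : ∀ g, HasDeg (y g) D := by
    intro g
    have hPg : P g ∈ lowDeg (ZMod 2) (n + 1) D := lowDeg_mono (le_max_left d 1) (hP g)
    exact hasDeg_transport hone (P g) hPg g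
  have hwin := hW n hn₀n D hD y hdeg
  -- split the solved patterns by the parity of the number of zeros
  set Sx := univ.filter fun x : Fin (n + 1) → Bool => Rel x (z x) with hSx
  set OddZ : (Fin (n + 1) → Bool) → Prop := fun x =>
    (univ.filter fun j : Fin (n + 1) => x j = false).card % 2 = 1 with hOddZ
  have hsplit : Sx.card = (Sx.filter OddZ).card + (Sx.filter fun x => ¬ OddZ x).card :=
    (Finset.card_filter_add_card_filter_not _).symm
  have heven : (Sx.filter fun x => ¬ OddZ x).card ≤ 2 ^ n := by
    refine le_trans (Finset.card_le_card ?_) card_even_class_le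
    intro x hx
    rw [mem_filter] at hx ⊢
    exact ⟨mem_univ _, hx.2⟩
  have hodd : (Sx.filter OddZ).card ≤
      (univ.filter fun u : Fin n → Bool => ringWinU (n + 2) y u = true).card := by
    refine Finset.card_le_card_of_injOn uVec ?_ ?_
    · intro x hx
      rw [Finset.mem_coe, mem_filter, hSx, mem_filter] at hx
      rw [Finset.mem_coe, mem_filter]
      exact ⟨mem_univ _, (rel_iff_ringWinU (by omega) x hx.2 z).1 hx.1.2⟩
    · intro x₁ hx₁ x₂ hx₂ h
      rw [Finset.mem_coe, mem_filter] at hx₁ hx₂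
      rw [← xOfU_uVec (by omega) x₁ hx₁.2, ← xOfU_uVec (by omega) x₂ hx₂.2, h]
  -- arithmetic
  have hS : (Sx.card : ℝ) ≤ 2 ^ n + θ' * 2 ^ n := by
    have h1 : (Sx.card : ℝ) ≤ ((Sx.filter fun x => ¬ OddZ x).card : ℝ) +
        ((Sx.filter OddZ).card : ℝ) := by
      rw [hsplit]; push_cast; linarith
    have h2 : ((Sx.filter fun x => ¬ OddZ x).card : ℝ) ≤ 2 ^ n := by exact_mod_cast heven
    have h3 : ((Sx.filter OddZ).card : ℝ) ≤ θ' * 2 ^ n := le_trans (by exact_mod_cast hodd) hwin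
    linarith
  have hpow : (2 : ℝ) ^ (n + 1) = 2 * 2 ^ n := by ring
  calc (Sx.card : ℝ) ≤ 2 ^ n + θ' * 2 ^ n := hS
    _ = (1 + θ') / 2 * (2 : ℝ) ^ (n + 1) := by rw [hpow]; ring

/-! ### Fixed-degree corollaries (one `θ` for every constant degree) -/

/-- **The product game at any FIXED degree**: with the `μ` of `productHard_sqrtLog`, for every
`D` there is `L₀` such that all `(L, L')` product games with `L, L' ≥ L₀` at degree `D` lose
`≥ μ·2^{L+L'}` cells (`D ≤ c√(log₂ min(L,L'))` holds eventually). -/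
theorem productHard_fixedDeg :
    ∃ μ : ℝ, 0 < μ ∧ ∀ D : ℕ, ∃ L₀ : ℕ, ∀ L L' : ℕ, L₀ ≤ L → L₀ ≤ L' →
      ∀ X Y : (Fin L → Bool) → (Fin L' → Bool) → Bool,
        (∀ v, IsElimWin D (fun u => X u v)) → (∀ u, IsElimWin D (fun v => Y u v)) →
          μ * (2 : ℝ) ^ (L + L') ≤ (agreeCountR X Y : ℝ) := by
  obtain ⟨μ, hμ, c, hc, L₀, h⟩ := productHard_sqrtLog
  refine ⟨μ, hμ, fun D => ?_⟩
  -- `D ≤ c·√(log₂ m)` as soon as `log₂ m ≥ (D/c)²`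
  refine ⟨max L₀ (2 ^ Nat.ceil (((D : ℝ) / c) ^ 2)), fun L L' hL hL' X Y hX hY => ?_⟩
  have hmin : 2 ^ Nat.ceil (((D : ℝ) / c) ^ 2) ≤ min L L' :=
    le_min (le_trans (le_max_right _ _) hL) (le_trans (le_max_right _ _) hL')
  have hlog : Nat.ceil (((D : ℝ) / c) ^ 2) ≤ Nat.log 2 (min L L') :=
    Nat.le_log_of_pow_le (by norm_num) hmin
  have h1 : ((D : ℝ) / c) ^ 2 ≤ (Nat.log 2 (min L L') : ℝ) :=
    le_trans (Nat.le_ceil _) (by exact_mod_cast hlog)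
  have h2 : (D : ℝ) / c ≤ Real.sqrt (Nat.log 2 (min L L')) := by
    rw [← Real.sqrt_sq (show (0 : ℝ) ≤ (D : ℝ) / c by positivity)]
    exact Real.sqrt_le_sqrt h1
  have hD : (D : ℝ) ≤ c * Real.sqrt (Nat.log 2 (min L L')) := by
    calc (D : ℝ) = c * ((D : ℝ) / c) := by field_simp
      _ ≤ c * Real.sqrt (Nat.log 2 (min L L')) := mul_le_mul_of_nonneg_left h2 hc.le
  exact h L L' (le_trans (le_max_left _ _) hL) (le_trans (le_max_left _ _) hL') D hD X Y hX hY

/-- **The ring game at any FIXED degree**: with the `θ < 1` of `ringHard_sqrtLogDeg`, for every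
`d` and all large `n`, every tuple of `𝔽₂`-polynomials of degree `≤ d` satisfies the ring relation
on at most `θ·2ⁿ` inputs — one `θ` for all constant degrees (the cell's prose floor `2ⁿ/3^{d+2}`,
TARGET §16.0(iv), decays with `d`). -/
theorem ringHard_fixedDeg :
    ∃ θ : ℝ, θ < 1 ∧ ∀ d : ℕ, ∃ n₀ : ℕ, ∀ n ≥ n₀,
      ∀ P : Fin n → CubeFn (ZMod 2) n, (∀ i, P i ∈ lowDeg (ZMod 2) n d) →
        ((univ.filter fun x : Fin n → Bool => Rel x (fun i => decide (P i x = 1))).card : ℝ) ≤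
          θ * (2 : ℝ) ^ n := by
  obtain ⟨θ, hθ, c, hc, n₀, h⟩ := ringHard_sqrtLogDeg
  refine ⟨θ, hθ, fun d => ⟨max n₀ (2 ^ Nat.ceil (((d : ℝ) / c) ^ 2)), fun n hn P hP => ?_⟩⟩
  have hlog : Nat.ceil (((d : ℝ) / c) ^ 2) ≤ Nat.log 2 n :=
    Nat.le_log_of_pow_le (by norm_num) (le_trans (le_max_right _ _) hn)
  have h1 : ((d : ℝ) / c) ^ 2 ≤ (Nat.log 2 n : ℝ) :=
    le_trans (Nat.le_ceil _) (by exact_mod_cast hlog)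
  have h2 : (d : ℝ) / c ≤ Real.sqrt (Nat.log 2 n) := by
    rw [← Real.sqrt_sq (show (0 : ℝ) ≤ (d : ℝ) / c by positivity)]
    exact Real.sqrt_le_sqrt h1
  have hd : (d : ℝ) ≤ c * Real.sqrt (Nat.log 2 n) := by
    calc (d : ℝ) = c * ((d : ℝ) / c) := by field_simp
      _ ≤ c * Real.sqrt (Nat.log 2 n) := mul_le_mul_of_nonneg_left h2 hc.le
  exact h n (le_trans (le_max_left _ _) hn) d hd P hP

end Summit.QuantumAdvantage.AdviceFreeQNC0
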